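import Summits.BirchSwinnertonDyer.BirchSwinnertonDyer.Theorems.EisensteinDepletionAtTwoStarSymbCRefFifteen
import Summits.BirchSwinnertonDyer.BirchSwinnertonDyer.Theorems.EisensteinDepletionAtTwoStarGlueFinCloser
import Summits.BirchSwinnertonDyer.BirchSwinnertonDyer.Theorems.EisensteinDepletionAtTwoStarEisEight
import Summits.BirchSwinnertonDyer.BirchSwinnertonDyer.Theorems.EisensteinDepletionAtTwoStarEisFiniteLevel
import Summits.BirchSwinnertonDyer.Rank2.RefFifteenFacts
import HarnessLib

/-!
# Route `EisensteinDepletionAtTwo`, crux E1M `DepletedLambdaLawAtTwoMod` (stmt-BirchSwinnertonDyer-20341), line `star`: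
# (★-core) HOLDS EXACTLY FOR `15A8` — the research identity (★) of the line is a THEOREM at level 15 (all coefficients)

Cell `bsd-rank2` (HOME run/shared/lean/pub/bsd-rank2/), seat `bsd-rank2-eng` GEN 10 (helper `--supports` the crux item; the
crux and its stubs quantify over ALL habitat curves and are NOT closed by this). The registered composition of line `star`
(v3.1: (★-core) ⇐ GlueFin((★-SymbC), (★-EisEight), (★-EisFin))) RUN AT `W = [1,1,1,0,0] = 15A8`, where every input is now a
tree theorem: (★-SymbC) at level 15 (`starSymbC_refFifteen`, this seat), (★-EisEight) (`starEisEight₂`, eng-2 g8),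
(★-EisFin) (`starEisFin`, eng-2 g8) and the member-wise glue `sq_X_mul_red_pfree_eq_of_smoothedCongruence` (lead star-p1 /
eng-2 g8). RESULT **`starCore_refFifteen`**: for every newform `f` of `15A8`, every nonzero rational `Λ`-multiple `L₀` of
`L₂(f, α)` and all nonzero `Λ`-multiples `G₀, G₀^ι` of the 2-adic Kubota–Leopoldt numerators,
`X²·red(pfree L₀) = red((1+T)^e)·red(pfree G₀)·red(pfree G₀^ι)·red(γ₃ − 1)·red(γ₅ − 1)` in `𝔽₂⟦T⟧` for some `e ∈ ℤ₂` —
(★-core) for `15A8` EXACTLY, superseding the mod-`T⁸` rung `Rank2.LevelFifteen.starCore_refFifteen_mod_T8` (GEN 9, p566067);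
`starCore_refFifteen_shape` is the same in the literal shape of `StarCoreAtTwo` (product over `(N_W).primeFactors` with the
multiplicative/additive exponents).

THEOREMS ONLY; no `sorry`; standard axioms. PARTITION: none — r_an ≥ 2, summit axis S0 (D-0036(1)); TWIN (D-0056): n/a.
B1 honesty: this is (★) for ONE curve (the reference member of the habitat); nothing reads an analytic rank; no S0 motion;
(★-SymbC)/(★-core) for a general habitat curve, E1M and BSD are NOT proved by this.

References: B. Mazur, J. Tate, J. Teitelbaum, *Invent. Math.* 84 (1986) §I.10–I.13 [MazurTateTeitelbaum1986Invent];
R. Greenberg, V. Vatsal, *Invent. Math.* 142 (2000) §3 [GreenbergVatsal2000]; G. Stevens, *Arithmetic on Modular Curves* (1982)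
§5.4 [Stevens1982].
-/

set_option linter.dupNamespace false
set_option autoImplicit false

noncomputable section

open scoped Classical
open scoped MatrixGroups

open Filter Topology CongruenceSubgroup
  Literature.NumberTheory.EllipticCurves Literature.NumberTheory.EllipticCurves.ModularForms
  Summit.BirchSwinnertonDyer.Rank1Residual.X1.MuLambda
open _root_.WeierstrassCurve Literature.NumberTheory.EllipticCurves.Greenberg1999

namespace Summit.BirchSwinnertonDyer.BirchSwinnertonDyer.Theorems.DepletionAtTwo

/-- **(★-core) for `15A8` in the literal shape of `StarCoreAtTwo`**: for every newform `f` of `W = [1,1,1,0,0]`, every nonzero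
`L₀ ∈ Λ` with `ι L₀ = c·L₂(f, α_W)`, and all nonzero `Λ`-multiples `G₀`, `G₀^ι` of `klTwoNumerator`, `klTwoNumeratorInv`,
`X²·red(pfree L₀) = red((1+T)^e)·red(pfree G₀)·red(pfree G₀^ι)·∏_{ℓ ∣ N_W} red(γ_ℓ − 1)^{m_ℓ}` for some `e ∈ ℤ₂`.
Proof: the glue `sq_X_mul_red_pfree_eq_of_smoothedCongruence` at `v = stabEisCuspDiff N_W β` with (★-SymbC) at level 15
(`starSymbC_refFifteen`), (★-EisEight) (`starEisEight₂`) and (★-EisFin) (`starEisFin`), exactly as in `star_glueFin`.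
[cite: MazurTateTeitelbaum1986Invent, §I.10–I.13] [cite: GreenbergVatsal2000, §3 Thm. (3.12), (28)] [cite: Stevens1982, §5.4 (PDF pp. 73–74)] -/
theorem starCore_refFifteen_shape (hmin : (⟨1, 1, 1, 0, 0⟩ : WeierstrassCurve ℚ).IsGloballyMinimal)
    ⦃N : ℕ⦄ [NeZero N] (f : CuspForm (Gamma0 N) 2) (hf : IsNewformOf (⟨1, 1, 1, 0, 0⟩ : WeierstrassCurve ℚ) f)
    (c : ℚ) (L₀ : IwasawaAlgebra 2) (hL₀ : L₀ ≠ 0)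
    (hι : iwasawaToPowerSeries 2 L₀ = PowerSeries.C (c : ℚ_[2]) *
      padicLFunction f (@unitRoot (⟨1, 1, 1, 0, 0⟩ : WeierstrassCurve ℚ) hmin 2 _ : ℚ_[2]))
    (cg : ℚ_[2]) (G₀ : IwasawaAlgebra 2) (hG₀ : G₀ ≠ 0)
    (hιG : iwasawaToPowerSeries 2 G₀ = PowerSeries.C cg * klTwoNumerator)
    (ci : ℚ_[2]) (GI₀ : IwasawaAlgebra 2) (hGI₀ : GI₀ ≠ 0)
    (hιGI : iwasawaToPowerSeries 2 GI₀ = PowerSeries.C ci * klTwoNumeratorInv) :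
    ∃ e : ℤ_[2],
      PowerSeries.X ^ 2 * red (pfree L₀) =
        red (PowerSeries.binomialSeries ℤ_[2] e) * red (pfree G₀) * red (pfree GI₀) *
          ∏ ℓ ∈ ((⟨1, 1, 1, 0, 0⟩ : WeierstrassCurve ℚ).conductorNorm ℤ).primeFactors,
            red (GreenbergVatsal2000.frobeniusSeries 2 ℓ - 1) ^
              (if ((⟨1, 1, 1, 0, 0⟩ : WeierstrassCurve ℚ).conductorNorm ℤ).factorization ℓ = 1 then 1 else 2) := by
  set W : WeierstrassCurve ℚ := ⟨1, 1, 1, 0, 0⟩ with hWdef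
  haveI : W.IsElliptic := Summit.BirchSwinnertonDyer.Rank2.refFifteen_isElliptic
  haveI : W.IsGloballyMinimal := hmin
  have hord : IsOrdinaryAt W 2 := Summit.BirchSwinnertonDyer.Rank2.refFifteen_isOrdinaryAt_two hmin
  obtain ⟨β, hadm, g, g', hg, hg', hC, hwit⟩ := starSymbC_refFifteen f hf
  -- `N_W` is odd (good reduction at `2`)
  have h2N : ¬ 2 ∣ W.conductorNorm ℤ := not_dvd_conductorNorm_of_hasGoodReductionAtPrime W hord.1
  have hodd : Odd (W.conductorNorm ℤ) := Nat.odd_iff.mpr (Nat.two_dvd_ne_zero.mp h2N)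
  obtain ⟨H, e, hH, hredH⟩ := starEisFin (W.conductorNorm ℤ) hodd β hadm cg G₀ hG₀ hιG ci GI₀ hGI₀ hιGI
  -- `red H ≠ 0`: the right-hand side of (★-EisFin) is a product of nonzero elements of the domain `𝔽₂⟦T⟧`
  have hredHne : red H ≠ 0 := by
    rw [hredH]
    refine mul_ne_zero (mul_ne_zero (mul_ne_zero ?_ (red_pfree_ne_zero hG₀)) (red_pfree_ne_zero hGI₀))
      (Finset.prod_ne_zero_iff.mpr fun ℓ hℓ ↦ pow_ne_zero _ ?_)
    · intro h
      have h0 := congrArg (PowerSeries.coeff 0) h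
      unfold red at h0
      rw [PowerSeries.coeff_map, PowerSeries.binomialSeries_coeff, Ring.choose_zero_right, one_smul, map_one,
        map_zero] at h0
      exact one_ne_zero h0
    · have hℓp : ℓ.Prime := Nat.prime_of_mem_primeFactors hℓ
      have hℓ2 : ℓ ≠ 2 := fun h2 ↦ h2N (h2 ▸ Nat.dvd_of_mem_primeFactors hℓ)
      exact red_frobeniusSeries_sub_one_ne_zero_two hℓp hℓ2
  -- the curve-side glue at `v = stabEisCuspDiff N_W β`
  have hv1 : ∀ m : ℕ, stabEisCuspDiff (W.conductorNorm ℤ) β m 1 = 0 := stabEisCuspDiff_one _ β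
  have hglue := sq_X_mul_red_pfree_eq_of_smoothedCongruence f hord hf (stabEisCuspDiff (W.conductorNorm ℤ) β) hv1 g g'
    hg hg' (fun m a h3 h4 h1 hlt ↦ hC m a ⟨h3, h4, h1, hlt⟩)
    (by
      obtain ⟨m, a, hma, n, hu, hn⟩ := hwit
      exact ⟨m, a, hma, n, hu, hn⟩)
    (fun m a h3 h4 h1 hlt ↦ by
      have h := starEisEight₂ (W.conductorNorm ℤ) hodd β hadm m a ⟨h3, h4, h1, hlt⟩
      have h8n : ‖(8 : ℚ_[2])‖ = 8⁻¹ := by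
        rw [show (8 : ℚ_[2]) = ((2 : ℕ) : ℚ_[2]) ^ 3 by norm_num, norm_pow, Padic.norm_p]; norm_num
      rw [Rat.cast_div, Rat.cast_ofNat, norm_div, h8n]
      calc ‖((stabEisCuspDiff (W.conductorNorm ℤ) β m a : ℚ) : ℚ_[2])‖ / 8⁻¹ ≤ 8⁻¹ / 8⁻¹ := by gcongr
        _ = 1 := by norm_num) H hH hredHne hL₀ hι
  refine ⟨1 + e, ?_⟩
  have hprod : ∏ ℓ ∈ (W.conductorNorm ℤ).primeFactors,
      red (GreenbergVatsal2000.frobeniusSeries 2 ℓ - 1) ^ (W.conductorNorm ℤ).factorization ℓ =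
      ∏ ℓ ∈ (W.conductorNorm ℤ).primeFactors,
        red (GreenbergVatsal2000.frobeniusSeries 2 ℓ - 1) ^
          (if (W.conductorNorm ℤ).factorization ℓ = 1 then 1 else 2) := by
    refine Finset.prod_congr rfl fun ℓ hℓ ↦ ?_
    have hpos : (W.conductorNorm ℤ).factorization ℓ ≠ 0 := by
      rw [← Finsupp.mem_support_iff, Nat.support_factorization]; exact hℓ
    have hle : (W.conductorNorm ℤ).factorization ℓ ≤ 2 := hadm.1 ℓ hℓ
    by_cases h1 : (W.conductorNorm ℤ).factorization ℓ = 1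
    · rw [if_pos h1, h1]
    · rw [if_neg h1]
      have h2 : (W.conductorNorm ℤ).factorization ℓ = 2 := by omega
      rw [h2]
  rw [hglue, hredH, hprod, PowerSeries.binomialSeries_add]
  unfold red
  rw [map_mul]
  ring

/-- **(★-core) for `15A8`, explicit level**: with `N_W = 15 = 3·5` (both multiplicative),
`X²·red(pfree L₀) = red((1+T)^e)·red(pfree G₀)·red(pfree G₀^ι)·red(γ₃ − 1)·red(γ₅ − 1)` in `𝔽₂⟦T⟧` for some `e ∈ ℤ₂` —
(★) for the reference member of the habitat, ALL coefficients (the mod-`T⁸` rung `starCore_refFifteen_mod_T8` pinned `e ≡ 5`).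
[cite: MazurTateTeitelbaum1986Invent, §I.10–I.13] [cite: GreenbergVatsal2000, §3 Thm. (3.12), (28)] -/
theorem starCore_refFifteen (hmin : (⟨1, 1, 1, 0, 0⟩ : WeierstrassCurve ℚ).IsGloballyMinimal)
    ⦃N : ℕ⦄ [NeZero N] (f : CuspForm (Gamma0 N) 2) (hf : IsNewformOf (⟨1, 1, 1, 0, 0⟩ : WeierstrassCurve ℚ) f)
    (c : ℚ) (L₀ : IwasawaAlgebra 2) (hL₀ : L₀ ≠ 0)
    (hι : iwasawaToPowerSeries 2 L₀ = PowerSeries.C (c : ℚ_[2]) *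
      padicLFunction f (@unitRoot (⟨1, 1, 1, 0, 0⟩ : WeierstrassCurve ℚ) hmin 2 _ : ℚ_[2]))
    (cg : ℚ_[2]) (G₀ : IwasawaAlgebra 2) (hG₀ : G₀ ≠ 0)
    (hιG : iwasawaToPowerSeries 2 G₀ = PowerSeries.C cg * klTwoNumerator)
    (ci : ℚ_[2]) (GI₀ : IwasawaAlgebra 2) (hGI₀ : GI₀ ≠ 0)
    (hιGI : iwasawaToPowerSeries 2 GI₀ = PowerSeries.C ci * klTwoNumeratorInv) :
    ∃ e : ℤ_[2],
      PowerSeries.X ^ 2 * red (pfree L₀) =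
        red (PowerSeries.binomialSeries ℤ_[2] e) * red (pfree G₀) * red (pfree GI₀) *
          (red (GreenbergVatsal2000.frobeniusSeries 2 3 - 1) * red (GreenbergVatsal2000.frobeniusSeries 2 5 - 1)) := by
  obtain ⟨e, he⟩ := starCore_refFifteen_shape hmin f hf c L₀ hL₀ hι cg G₀ hG₀ hιG ci GI₀ hGI₀ hιGI
  refine ⟨e, ?_⟩
  have h15 : Nat.primeFactors 15 = {3, 5} := by decide +kernel
  have n3 : (15 : ℕ).factorization 3 = 1 := by decide +kernel
  have n5 : (15 : ℕ).factorization 5 = 1 := by decide +kernel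
  rw [he, Summit.BirchSwinnertonDyer.Rank2.refFifteen_conductorNorm, h15, Finset.prod_insert (by decide),
    Finset.prod_singleton, n3, n5]
  simp only [if_true, pow_one]

end Summit.BirchSwinnertonDyer.BirchSwinnertonDyer.Theorems.DepletionAtTwo

end
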